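import Literature.Barriers.BirchSwinnertonDyer.PAdicFunctionalEquationParityLambdaTwoProofs
import Literature.NumberTheory.EllipticCurves.PAdicLFunctionMultiplicativeFunctionalEquationProofs
import Literature.NumberTheory.EllipticCurves.AtkinLehnerInvolutionsNewformProofs
import HarnessLib

/-!
# PARITY(2) at a MULTIPLICATIVE `2`: `(−1)^λ = χ₈(M)`, `M = N_E/2` the odd part of the conductor

Proofs-companion of `PAdicFunctionalEquationParityLambdaTwoProofs.lean` (PARITY(2) for curves good
ordinary at `2`, `(−1)^λ = χ₈(N_E)`). Theorems only, no named fact. O1 class-closure (X5, `p = 2`,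
non-CM), typer cc-typer-4 gen 4: the o1 refuter (REFUTER-O1 v7 §29 (2), 2026-08-21) observed that the
multiplicative functional equation at `p = 2` IS a tree theorem —
`IsSplitMultPAdicLFunctionOf.subst_eq_of_atkinLehner` / `IsMultPAdicLFunctionOf.subst_eq_of_atkinLehner`
(`PAdicLFunctionMultiplicativeFunctionalEquationProofs.lean`; Mazur–Tate–Teitelbaum 1986 §I.17:
`L(ι(T)) = σ · (1+T)^c · L(T)` with `⟨M⟩ = γ^c`, `M` the prime-to-`p` part of the level, `w_M f = −σ f`,
NO parity binder) — so the o1 lead's D18 item 3 ("multiplicative 2 has no FE in the tree") is void and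
the PARITY(2) law extends VERBATIM to curves with multiplicative reduction at `2`, split or non-split,
with `N_E` replaced by `M = N_E/2`: the core lemma `norm_natCast_sub_le_of_subst_invOnePlusSubOne_eq`
(`n ≡ c (mod 2)` for the first unit coefficient `n` of an integral `g` with `g(T^ι) = σ(1+T)^c g`) is
sign-blind, and `M ≡ η · 5^c (mod 8)`, `η = ±1`, gives `c` even `↔ M ≡ ±1 (mod 8)`.

* `even_firstUnitCoeff_iff_oddLevel_mod_eight_of_isSplitMultPAdicLFunctionOf` — `E` SPLIT
  multiplicative at `2`, `L` THE `2`-adic `L`-function of the package `IsSplitMultPAdicLFunctionOf f 2 L`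
  (MTT §I.10, `α = a₂ = 1`; it has the trivial zero `L(0) = 0`, so `n ≥ 1` automatically), `t` any
  normalising scalar with `t·L` `2`-integral, `n` the first unit coefficient of `t·L`: `n` even
  `↔ M % 8 ∈ {1, 7}`.
* `even_firstUnitCoeff_iff_oddLevel_mod_eight_of_isMultPAdicLFunctionOf_neg_one` — the NON-SPLIT twin
  (`IsMultPAdicLFunctionOf f 2 (−1) L`).
The Atkin–Lehner sign `σ` exists for the newform (`IsNewform0.exists_atkinLehnerInvolution_eq_smul`,
Knapp Thm. 9.27(b)) and does NOT enter the conclusion (`σ ≡ 1 (mod 2)`), exactly as the root number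
does not enter at good `2`. Census use (o1 lead PREDICTIONS-P10 §3 C7, EVIDENCE): lens-3 GEN 6 checked
`λ_an ≡ [N_odd ≡ ±3 (mod 8)] (mod 2)` on 712/712 split rows before this proof; not used here.

## References

* B. Mazur, J. Tate, J. Teitelbaum, *On `p`-adic analogues of the conjectures of Birch and
  Swinnerton-Dyer*, Invent. Math. 84 (1986), §I.17 (functional equation). [MazurTateTeitelbaum1986Invent]
* R. Greenberg, *Iwasawa theory for elliptic curves*, LNM 1716 (1999), §1 pp. 67–68 (`⟨·⟩ = γ^c`),
  §5 p. 181 (`a = −2` at `p = 2`). [GreenbergLNM1716]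
* A. W. Knapp, *Elliptic curves* (1993), Thm. 9.27(b) (Atkin–Lehner eigenvalues of newforms). [Knapp1993]
-/

noncomputable section

open scoped MatrixGroups ModularForm

open CongruenceSubgroup PowerSeries WeierstrassCurve Filter Topology
  Literature.NumberTheory.EllipticCurves Literature.NumberTheory.EllipticCurves.ModularForms

namespace Literature.Barriers.BirchSwinnertonDyer

section Mult

/-- `‖n − c‖₂ ≤ ½` for `n ∈ ℕ`, `c ∈ ℤ₂` means `n ≡ c (mod 2)`: `(n : ℤ/2) = c mod 2` (private
bookkeeping, as in the good-ordinary file). [folklore] -/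
private theorem natCast_eq_toZModPow_one_of_norm_sub_le' {n : ℕ} {c : ℤ_[2]}
    (h : ‖(n : ℚ_[2]) - (c : ℚ_[2])‖ ≤ 2⁻¹) : (n : ZMod 2) = PadicInt.toZModPow 1 c := by
  have hlt : ‖((n : ℤ_[2]) - c : ℤ_[2])‖ < 1 := by
    rw [PadicInt.norm_def, PadicInt.coe_sub, PadicInt.coe_natCast]
    exact h.trans_lt (by norm_num)
  have hdvd : ((2 : ℕ) : ℤ_[2]) ∣ (n : ℤ_[2]) - c := (PadicInt.norm_lt_one_iff_dvd _).mp hlt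
  have hker : ((n : ℤ_[2]) - c) ∈ RingHom.ker (PadicInt.toZModPow (p := 2) 1) := by
    rw [PadicInt.ker_toZModPow, Ideal.mem_span_singleton, pow_one]
    exact hdvd
  rw [RingHom.mem_ker, map_sub, map_natCast, sub_eq_zero] at hker
  exact hker

/-- **The mod-`8` bookkeeping**: if `η · 5^{c} ≡ M` at level `3` (`η = ±1` a `2`-adic root of unity,
`c ∈ ℤ₂` — the exponent of `⟨M⟩ = 5^c`), and `n ≡ c (mod 2)`, then `n` is even iff
`M ≡ ±1 (mod 8)`. Private arithmetic shared by the split and non-split statements. [folklore] -/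
private theorem even_iff_mod_eight_of_exponent {M : ℕ} {n : ℕ}
    {ηM : rootsOfUnity (torsionOrder 2) ℤ_[2]} {c : ℤ_[2]}
    (hc : ∀ k : ℕ, PadicInt.toZModPow (k + cyclotomicExponent 2) ((ηM : ℤ_[2]ˣ) : ℤ_[2]) *
        (cyclotomicGenerator 2 : ZMod (2 ^ (k + cyclotomicExponent 2))) ^
          (PadicInt.toZModPow k c).val = (M : ZMod (2 ^ (k + cyclotomicExponent 2))))
    (hpar : (n : ZMod 2) = PadicInt.toZModPow 1 c) :
    Even n ↔ (M % 8 = 1 ∨ M % 8 = 7) := by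
  -- `η = ±1`
  have hη : ((ηM : ℤ_[2]ˣ) : ℤ_[2]) = 1 ∨ ((ηM : ℤ_[2]ˣ) : ℤ_[2]) = -1 := by
    have h := ηM.2
    rw [mem_rootsOfUnity] at h
    have h' : (((ηM : ℤ_[2]ˣ) : ℤ_[2])) ^ torsionOrder 2 = 1 := by
      rw [← Units.val_pow_eq_pow_val, h, Units.val_one]
    generalize ((ηM : ℤ_[2]ˣ) : ℤ_[2]) = x at h' ⊢
    rw [torsionOrder_two] at h'
    exact sq_eq_one_iff.mp h'
  -- `M ≡ η · 5^{c mod 2} (mod 8)`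
  have h8 : PadicInt.toZModPow 3 ((ηM : ℤ_[2]ˣ) : ℤ_[2]) *
      (5 : ZMod 8) ^ (PadicInt.toZModPow 1 c).val = ((M : ℕ) : ZMod 8) := by
    have h := hc 1
    rw [cyclotomicGenerator_two] at h
    exact_mod_cast h
  have hη8 : PadicInt.toZModPow 3 ((ηM : ℤ_[2]ˣ) : ℤ_[2]) = 1 ∨
      PadicInt.toZModPow 3 ((ηM : ℤ_[2]ˣ) : ℤ_[2]) = -1 := by
    rcases hη with h | h
    · exact Or.inl (by rw [h, map_one])
    · exact Or.inr (by rw [h, map_neg, map_one])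
  have hM8 : M % 8 = (((M : ℕ) : ZMod 8)).val := by
    rw [ZMod.val_natCast]
  rw [← ZMod.natCast_eq_zero_iff_even, hpar, ← ZMod.val_eq_zero, hM8, ← h8]
  set v : ℕ := (PadicInt.toZModPow 1 c).val with hv
  have hvlt : v < 2 := ZMod.val_lt _
  interval_cases v
  · rcases hη8 with h | h <;> rw [h] <;> decide
  · rcases hη8 with h | h <;> rw [h] <;> decide

variable {W : WeierstrassCurve ℚ}

/-- **PARITY(2) at a SPLIT multiplicative `2`: `(−1)^λ = χ₈(M)`, `M = N_E/2`.** Let `E = W/ℚ` have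
split multiplicative reduction at `2`, newform `f ∈ S₂(Γ₀(N))` with `N = 2M`, `M` odd (for the
conductor level this is automatic: `2 ‖ N_E`), and let `L` be THE `2`-adic `L`-function of the pair
(`IsSplitMultPAdicLFunctionOf f 2 L`, MTT §I.10 with `α = a₂ = 1`; unique, bsd.S23). For any scalar
`t ∈ ℚ₂` such that `t · L` has `2`-integral coefficients, if `n` is the index of the first UNIT
coefficient of `t · L` (all earlier ones in `2ℤ₂`; for `t = 2^{−μ(L)}` this `n` is `λ(L)`, and
`n ≥ 1` because of the trivial zero `L(0) = 0`), then `n` is even iff `M ≡ ±1 (mod 8)`. Inputs: the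
functional equation `L(T^ι) = σ (1+T)^c L(T)`, `⟨M⟩ = 5^c`
(`IsSplitMultPAdicLFunctionOf.subst_eq_of_atkinLehner`, MTT §I.17 — NO parity binder), the
Atkin–Lehner sign of the newform (`IsNewform0.exists_atkinLehnerInvolution_eq_smul`), the exponent
(`exists_teichmuller_exponent_natCast`), the core `norm_natCast_sub_le_of_subst_invOnePlusSubOne_eq`,
and `5^c ≡ 1 (mod 8) ↔ c` even. The sign `σ` does NOT enter.
[cite: MazurTateTeitelbaum1986Invent, §I.17 (functional equation at p ∣ N, ⟨M⟩)]
[cite: GreenbergLNM1716, §1 pp. 67–68 and §5 p. 181] [cite: Knapp1993, Thm. 9.27(b)] -/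
theorem even_firstUnitCoeff_iff_oddLevel_mod_eight_of_isSplitMultPAdicLFunctionOf
    {N : ℕ} [NeZero N] {f : CuspForm (Gamma0 N) 2}
    (hsp : W.HasSplitMultiplicativeReductionAtPrime 2) (hf : IsNewformOf W f)
    {M : ℕ} (hNM : N = 2 * M) (h2M : ¬ 2 ∣ M)
    {L : PowerSeries ℚ_[2]} (hL : IsSplitMultPAdicLFunctionOf f 2 L) (t : ℚ_[2]) {n : ℕ}
    (hint : ∀ k, ‖coeff k (C t * L)‖ ≤ 1)
    (hsmall : ∀ j < n, ‖coeff j (C t * L)‖ ≤ 2⁻¹) (hunit : ‖coeff n (C t * L)‖ = 1) :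
    Even n ↔ (M % 8 = 1 ∨ M % 8 = 7) := by
  have hM0 : M ≠ 0 := by rintro rfl; exact h2M (dvd_zero 2)
  haveI : NeZero M := ⟨hM0⟩
  -- the Atkin–Lehner sign at `M`: `w_M f = ε f`, `ε = ±1`; write `ε = −σ`
  have hMN : M ∣ N := ⟨2, by rw [hNM, mul_comm]⟩
  have hcop : Nat.Coprime M (N / M) := by
    rw [hNM, mul_comm, Nat.mul_div_cancel_left 2 (Nat.pos_of_ne_zero hM0)]
    exact ((Nat.Prime.coprime_iff_not_dvd Nat.prime_two).mpr h2M).symm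
  obtain ⟨ε, hε, hWε⟩ := hf.1.exists_atkinLehnerInvolution_eq_smul (N := N) (k := (2 : ℤ)) hMN hcop
  obtain ⟨σ, hσ, hσε⟩ : ∃ σ : ℤ, σ ^ 2 = 1 ∧ (-(σ : ℂ)) = ε := by
    rcases hε with rfl | rfl
    · exact ⟨-1, by norm_num, by push_cast; ring⟩
    · exact ⟨1, by norm_num, by push_cast; ring⟩
  have hW : atkinLehnerInvolution N 2 M f = (-(σ : ℂ)) • f := by rw [hσε]; exact hWε
  -- the exponent `⟨M⟩ = 5^c`, `M ≡ η 5^c`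
  obtain ⟨ηM, c, hc⟩ := exists_teichmuller_exponent_natCast 2 h2M
  -- the functional equation for `L`, hence for `t · L`
  have hFE := hL.subst_eq_of_atkinLehner hsp hf hNM h2M hσ hW hc
    one_add_X_mul_invOnePlusSubOne_add_one
  have hFEg : (C t * L).subst (invOnePlusSubOne : ℚ_[2]⟦X⟧) =
      C (((σ : ℤ) : ℚ_[2])) * binomialSeries ℚ_[2] c * (C t * L) := by
    rw [← smul_eq_C_mul, subst_smul hasSubst_invOnePlusSubOne t L, hFE, smul_eq_C_mul,
      smul_eq_C_mul]
    ring
  have hσ' : ((σ : ℤ) : ℚ_[2]) = 1 ∨ ((σ : ℤ) : ℚ_[2]) = -1 := by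
    rcases sq_eq_one_iff.mp hσ with h | h <;> simp [h]
  have hpar := natCast_eq_toZModPow_one_of_norm_sub_le'
    (norm_natCast_sub_le_of_subst_invOnePlusSubOne_eq hσ' hFEg hint hsmall hunit)
  exact even_iff_mod_eight_of_exponent hc hpar

/-- **PARITY(2) at a NON-SPLIT multiplicative `2`: `(−1)^λ = χ₈(M)`, `M = N_E/2`.** As the split
statement, for `L` THE `2`-adic `L`-function of the non-split package `IsMultPAdicLFunctionOf f 2 (−1) L`
(MTT §I.10 with `α = a₂ = −1`; no trivial zero) and its functional equation
`IsMultPAdicLFunctionOf.subst_eq_of_atkinLehner` (MTT §I.17). The sign `σ` (here the root number) does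
NOT enter. [cite: MazurTateTeitelbaum1986Invent, §I.17 (functional equation at p ∣ N, ⟨M⟩)]
[cite: GreenbergLNM1716, §1 pp. 67–68 and §5 p. 181] [cite: Knapp1993, Thm. 9.27(b)] -/
theorem even_firstUnitCoeff_iff_oddLevel_mod_eight_of_isMultPAdicLFunctionOf_neg_one
    {N : ℕ} [NeZero N] {f : CuspForm (Gamma0 N) 2} (hf : IsNewformOf W f)
    (hmult : W.HasMultiplicativeReductionAtPrime 2) (hns : ¬ W.HasSplitMultiplicativeReductionAtPrime 2)
    {M : ℕ} (hNM : N = 2 * M) (h2M : ¬ 2 ∣ M)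
    {L : PowerSeries ℚ_[2]} (hL : IsMultPAdicLFunctionOf f 2 (-1) L) (t : ℚ_[2]) {n : ℕ}
    (hint : ∀ k, ‖coeff k (C t * L)‖ ≤ 1)
    (hsmall : ∀ j < n, ‖coeff j (C t * L)‖ ≤ 2⁻¹) (hunit : ‖coeff n (C t * L)‖ = 1) :
    Even n ↔ (M % 8 = 1 ∨ M % 8 = 7) := by
  have hM0 : M ≠ 0 := by rintro rfl; exact h2M (dvd_zero 2)
  haveI : NeZero M := ⟨hM0⟩
  have hMN : M ∣ N := ⟨2, by rw [hNM, mul_comm]⟩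
  have hcop : Nat.Coprime M (N / M) := by
    rw [hNM, mul_comm, Nat.mul_div_cancel_left 2 (Nat.pos_of_ne_zero hM0)]
    exact ((Nat.Prime.coprime_iff_not_dvd Nat.prime_two).mpr h2M).symm
  obtain ⟨ε, hε, hWε⟩ := hf.1.exists_atkinLehnerInvolution_eq_smul (N := N) (k := (2 : ℤ)) hMN hcop
  obtain ⟨σ, hσ, hσε⟩ : ∃ σ : ℤ, σ ^ 2 = 1 ∧ (-(σ : ℂ)) = ε := by
    rcases hε with rfl | rfl
    · exact ⟨-1, by norm_num, by push_cast; ring⟩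
    · exact ⟨1, by norm_num, by push_cast; ring⟩
  have hW : atkinLehnerInvolution N 2 M f = (-(σ : ℂ)) • f := by rw [hσε]; exact hWε
  obtain ⟨ηM, c, hc⟩ := exists_teichmuller_exponent_natCast 2 h2M
  have hFE := hL.subst_eq_of_atkinLehner hf hmult hns hNM h2M hσ hW hc
    one_add_X_mul_invOnePlusSubOne_add_one
  have hFEg : (C t * L).subst (invOnePlusSubOne : ℚ_[2]⟦X⟧) =
      C (((σ : ℤ) : ℚ_[2])) * binomialSeries ℚ_[2] c * (C t * L) := by
    rw [← smul_eq_C_mul, subst_smul hasSubst_invOnePlusSubOne t L, hFE, smul_eq_C_mul,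
      smul_eq_C_mul]
    ring
  have hσ' : ((σ : ℤ) : ℚ_[2]) = 1 ∨ ((σ : ℤ) : ℚ_[2]) = -1 := by
    rcases sq_eq_one_iff.mp hσ with h | h <;> simp [h]
  have hpar := natCast_eq_toZModPow_one_of_norm_sub_le'
    (norm_natCast_sub_le_of_subst_invOnePlusSubOne_eq hσ' hFEg hint hsmall hunit)
  exact even_iff_mod_eight_of_exponent hc hpar

end Mult

end Literature.Barriers.BirchSwinnertonDyer

end
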